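import Mathlib.LinearAlgebra.FreeModule.StrongRankCondition
import Summits.HodgeConjecture.CorCM.Census.GroupFreeFaceBasisRank
import Summits.HodgeConjecture.CorCM.FaceBasisDictionary
import Summits.HodgeConjecture.CorCM.FaceCensusGroupDictionary
import Summits.HodgeConjecture.CorCM.FaceCensusTransport
import HarnessLib

/-!
# The face-basis FLOOR: a set of faces of a Galois CM field of degree `2n` whose Weil characters generate those of all faces has at
# least `(2^{n−1} − n)/n` members — and the Weil character at the conjugate base embedding is the negative

COR-CM (cell `pub-hodgecm2`), count-neutral kernel combinatorics by the binder seat b09 (gen 27; lane GROUP-FREE-FACE-BASIS, André-3's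
ask A6-R46), part VI, sequel of `CorCM/FaceBasisDictionary.lean` (the dictionary `vecOf T₀`) and `Census/GroupFreeFaceBasisRank.lean`
(`finrank (H/P) = 2^{n−1} − n`).  Theorems only; no `decide`, no certificate, no named fact, no `sorry`; `Interfaces.lean` (C1), every
E term, B01, `Transposition/*` untouched.  HONEST FRAMING: `HC_CM` is NOT proved, here or anywhere in the tree; nothing here is a
period.  T5: n/a-class — the one Prop binder of the floor theorem is the generation binder `hgen(𝒮, σ₀)` of INT2-GEN
(`CorCM/FacePeriodsGeneratingSet.lean`), INHABITED for the basis faces by `FaceBasis.basisFace_hgen` (part V) — no contradiction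
derivable; no named-fact / conjecture-def binder; checker: self (prover-pub-hodgecm2-b09-g27-0), 2026-08-22.

CONTENT (`F` a Galois CM field, `[IsCMField F] [IsGalois ℚ F]`; `n = [F:ℚ]/2`).
* §1 Complex conjugation is CENTRAL among the Galois translates of a CM field (`GalT.apply_conjugate`, `conjT_comm`; from seat b23's
  `exists_conjAut` / `comp_conjAut`, `CorCM/FaceCensusGroupDictionary.lean`), hence `pullType Θ σ̄ = barCM (pullType Θ σ)`
  (`pullType_conjugate`) and `translate σ̄ ρ = translate σ ρ · conjT` (`translate_conjugate_base`, any Galois `F`).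
* §2 **The Weil character at the conjugate base embedding is the negative** (`lefChar_corner_conjugate`:
  `lefChar f.corner (fun _ ↦ {σ̄}) = − lefChar f.corner (fun _ ↦ {σ})` for every face `f` and every `σ`): through the dictionary the
  `σ̄`-read is `faceVec (φ + 1) i j ≡ − faceVec φ i j (mod pairs)` (`vecOf_weightRel_corner_conjugate`, `faceVec_add_one_add_mem_pairs`).
* §3 **THE FLOOR** (`two_pow_le_of_hgen`): if a finite set `𝒮` of faces satisfies the generation binder `hgen(𝒮, σ₀)` — the
  `σ₀`-Weil character of every face lies in the subgroup generated by the Weil characters of the faces of `𝒮` at all base embeddings —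
  then `2^{n−1} ≤ n·|𝒮| + n`, i.e. **`|𝒮| ≥ (2^{n−1} − n)/n`**: by §2 the `2n` reads of a face span, modulo pairs, what `n` of them span,
  and the image of the Hodge lattice in `ℤ^{labels}/P` — free of rank `2^{n−1} − n` by part III, spanned by the face classes by part I —
  lies in their span.  With part V (`|𝒮| ≤ 2^{n−1} − n` suffices) this brackets, for EVERY Galois CM field of degree `2n` and with no
  census, the number of faces a face-period route must treat: `⌈(2^{n−1} − n)/n⌉ ≤ min |𝒮| ≤ 2^{n−1} − n` — at degree `20`: between `51`
  and `502` (André-3's per-type minima `51, 51, 54, 66` sit in this window); `93 … 1013` at degree `22`; `170 … 2036` at degree `24`.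

## References
* [Pohlmann1968] H. Pohlmann, Algebraic cycles on abelian varieties of complex multiplication type, Ann. of Math. 88 (1968), Thm 1.
* [Milne1999LefschetzClasses] J. S. Milne, Lefschetz classes on abelian varieties, Duke Math. J. 96 (1999), Thm. 3.2.
* [Shimura1998] G. Shimura, Abelian varieties with complex multiplication and modular functions, §8.1 (p. 62).
-/

noncomputable section

open NumberField NumberField.ComplexEmbedding
open scoped symmDiff

namespace Summit.HodgeConjecture.CorCM.FaceBasis

open Literature.AlgebraicGeometry.Motives (CMType)
open Literature.NumberTheory.ComplexMultiplication.CMTypeOps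
open Summit.HodgeConjecture.CorCM.Prior.AllgGroup.RfwfAllgGroup
open Summit.HodgeConjecture.CorCM.Census.OddSliceFacesModel (Ty hodge pairs pairVec δ add_one_add_one)
open Summit.HodgeConjecture.CorCM.Census.OddSliceFacesSquares (faceVec)
open Summit.HodgeConjecture.CorCM.Census.GroupFreeFaceBasis (BIdx bvec exists_selector)
open Summit.HodgeConjecture.CorCM.Census.GroupFreeFaceCoordinates (span_mkQ_bvec_eq)
open Summit.HodgeConjecture.CorCM.Census.GroupFreeFaceBasisRank (finrank_hodge_mod_pairs)

variable {F : Type} [Field F] [NumberField F]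

/-! ## §1 Complex conjugation is central among the Galois translates of a CM field -/

/-- **A Galois translate of a CM field commutes with complex conjugation of embeddings**: `P σ̄ = \overline{P σ}`. [folklore] -/
theorem GalT.apply_conjugate [IsCMField F] [IsGalois ℚ F] (P : GalT F) (σ : F →+* ℂ) :
    P.1 (conjugate σ) = conjugate (P.1 σ) := by
  obtain ⟨c, hc⟩ := FaceCensus.exists_conjAut σ
  rw [← hc, GalT.apply_comp, FaceCensus.comp_conjAut σ hc (P.1 σ)]

/-- `conjT` is central in `GalT F` for a CM field. [folklore] -/
theorem conjT_comm [IsCMField F] [IsGalois ℚ F] (P : GalT F) : P * conjT = conjT * P := by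
  apply Subtype.ext
  ext σ : 1
  change P.1 ((conjT : GalT F).1 σ) = (conjT : GalT F).1 (P.1 σ)
  rw [conjT_apply, conjT_apply, GalT.apply_conjugate]

/-- **Pulling back along the conjugate base embedding conjugates the abstract type**: `pullType Θ σ̄ = barCM (pullType Θ σ)`. [folklore] -/
theorem pullType_conjugate [IsCMField F] [IsGalois ℚ F] (Θ : CMType F) (σ : F →+* ℂ) :
    pullType Θ (conjugate σ) = barCM (pullType Θ σ) := by
  apply Subtype.ext
  ext P
  rw [mem_pullType, mem_barCM, mem_pullType, GalT.apply_conjugate]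
  have h := mem_iff_conjugate_notMem Θ (conjugate (P.1 σ))
  rw [involutive_conjugate F (P.1 σ)] at h
  exact h

/-- The translate carrying the conjugate base embedding `σ̄` to `ρ` is `translate σ ρ · conjT` (any Galois `F`). [folklore] -/
theorem translate_conjugate_base [IsGalois ℚ F] (σ ρ : F →+* ℂ) :
    translate (conjugate σ) ρ = translate σ ρ * conjT :=
  GalT.ext_of_apply (conjugate σ) (by simp [ComplexEmbedding.involutive_conjugate F σ])

/-! ## §2 Reads at conjugate base embeddings -/

/-- The place of `t` equals the place of any of its members. [folklore] -/
theorem orb_eq_of_mem_orb {t x : GalT F} (h : x ∈ orb conjT t) : orb conjT x = orb conjT t := by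
  rcases (mem_orb conjT).mp h with rfl | rfl
  · rfl
  · ext y
    rw [mem_orb, mem_orb, conj_conj]
    tauto

/-- Translates in the same place have the same representative in `T₀`. [folklore] -/
theorem rep_eq_of_mem_orb (T₀ : CMF (GalT F) conjT) {t x : GalT F} (h : x ∈ orb conjT t) : rep T₀ x = rep T₀ t := by
  by_contra hne
  have h1 := notMem_orb_of_ne T₀ hne
  apply h1
  rw [orb_eq_of_mem_orb (rep_mem_orb T₀ x), orb_eq_of_mem_orb h]
  exact rep_mem_orb T₀ t

/-- `rep (t · conjT) = rep t` for a CM field. [folklore] -/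
theorem rep_mul_conjT [IsCMField F] [IsGalois ℚ F] (T₀ : CMF (GalT F) conjT) (t : GalT F) :
    rep T₀ (t * conjT) = rep T₀ t :=
  rep_eq_of_mem_orb T₀ ((mem_orb conjT).mpr (Or.inr (conjT_comm t)))

/-- **The face class of the conjugate base type plus the face class is a sum of four pairs** (group-free):
`faceVec (φ + 1) i j + faceVec φ i j ∈ P`. [folklore] -/
theorem faceVec_add_one_add_mem_pairs (A : Type) [Fintype A] [DecidableEq A] (φ : Ty A) (i j : A) :
    faceVec A (φ + 1) i j + faceVec A φ i j ∈ pairs A := by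
  have e : faceVec A (φ + 1) i j + faceVec A φ i j =
      pairVec A φ + pairVec A (φ + δ A i) + pairVec A (φ + δ A j) + pairVec A (φ + δ A i + δ A j) := by
    unfold faceVec pairVec
    have l1 : φ + 1 + 1 + δ A i = φ + δ A i := by rw [add_one_add_one]
    have l2 : φ + 1 + 1 + δ A j = φ + δ A j := by rw [add_one_add_one]
    have l3 : φ + 1 + δ A i + δ A j = φ + δ A i + δ A j + 1 := by abel
    have l4 : φ + 1 + δ A i = φ + δ A i + 1 := by abel
    have l5 : φ + 1 + δ A j = φ + δ A j + 1 := by abel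
    rw [l1, l2, l3, l4, l5]
    abel
  rw [e]
  exact Submodule.add_mem _ (Submodule.add_mem _ (Submodule.add_mem _ (Submodule.subset_span ⟨_, rfl⟩)
    (Submodule.subset_span ⟨_, rfl⟩)) (Submodule.subset_span ⟨_, rfl⟩)) (Submodule.subset_span ⟨_, rfl⟩)

/-- **The corner indicator read at the conjugate base embedding** is the face class of the conjugate type at the same places.
[folklore] -/
theorem vecOf_weightRel_corner_conjugate [IsCMField F] [IsGalois ℚ F] (T₀ : CMF (GalT F) conjT) (f : Face F) (σ : F →+* ℂ) :
    vecOf T₀ (weightRel f.corner (fun _ => ({conjugate σ} : Finset (F →+* ℂ)))) =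
      faceVec (Pl T₀) (tyOf T₀ (pullType f.Φ σ) + 1) (rep T₀ (translate σ f.p)) (rep T₀ (translate σ f.p')) := by
  rw [vecOf_weightRel_corner, pullType_conjugate, tyOf_barCM, translate_conjugate_base, translate_conjugate_base, rep_mul_conjT,
    rep_mul_conjT]

/-- The two reads of a face at conjugate base embeddings sum to a pair relation. [folklore] -/
theorem weightRel_corner_conjugate_add_mem_pairRel [IsCMField F] [IsGalois ℚ F] (f : Face F) (σ : F →+* ℂ) :
    weightRel f.corner (fun _ => ({conjugate σ} : Finset (F →+* ℂ))) + weightRel f.corner (fun _ => ({σ} : Finset (F →+* ℂ)))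
      ∈ pairRel := by
  classical
  obtain ⟨T₀⟩ : Nonempty (CMF (GalT F) conjT) := ⟨pullType f.Φ σ⟩
  have hmem : vecOf T₀ (weightRel f.corner (fun _ => ({conjugate σ} : Finset (F →+* ℂ))) +
      weightRel f.corner (fun _ => ({σ} : Finset (F →+* ℂ)))) ∈
      (pairRel (F := F)).map (vecOf T₀ : (CMF (GalT F) conjT →₀ ℤ) →ₗ[ℤ] (Ty (Pl T₀) → ℤ)) := by
    rw [map_pairRel_eq, map_add, vecOf_weightRel_corner_conjugate, vecOf_weightRel_corner]
    exact faceVec_add_one_add_mem_pairs (Pl T₀) _ _ _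
  obtain ⟨y, hy, hyx⟩ := hmem
  rw [LinearEquiv.coe_coe] at hyx
  rwa [← (vecOf T₀).injective hyx]

/-- **The Weil character at the conjugate base embedding is the negative.** [folklore] -/
theorem lefChar_corner_conjugate [IsCMField F] [IsGalois ℚ F] (f : Face F) (σ : F →+* ℂ) :
    lefChar f.corner (fun _ => ({conjugate σ} : Finset (F →+* ℂ))) = -lefChar f.corner (fun _ => ({σ} : Finset (F →+* ℂ))) := by
  rw [← abar_weightRel, ← abar_weightRel, eq_neg_iff_add_eq_zero, ← map_add]
  exact (Submodule.Quotient.mk_eq_zero _).mpr (weightRel_corner_conjugate_add_mem_pairRel f σ)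

/-! ## §3 The floor -/

/-- **THE FACE-BASIS FLOOR.**  For a Galois CM field `F` of degree `2n` and ANY finite set `𝒮` of faces satisfying the generation
binder `hgen(𝒮, σ₀)` of INT2-GEN: `2^{n−1} ≤ n·|𝒮| + n`, i.e. `|𝒮| ≥ (2^{n−1} − n)/n` — no census, no certificate, every degree.
[folklore] -/
theorem two_pow_le_of_hgen [IsCMField F] [IsGalois ℚ F] (𝒮 : Finset (Face F)) (σ₀ : F →+* ℂ) (hne : Nonempty (Face F))
    (hgen : ∀ f : Face F, lefChar f.corner (fun _ => ({σ₀} : Finset (F →+* ℂ))) ∈ AddSubgroup.closure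
      {a : Asym F | ∃ g ∈ (𝒮 : Set (Face F)), ∃ σ : F →+* ℂ, a = lefChar g.corner (fun _ => ({σ} : Finset (F →+* ℂ)))}) :
    2 ^ (Module.finrank ℚ F / 2 - 1) ≤ Module.finrank ℚ F / 2 * 𝒮.card + Module.finrank ℚ F / 2 := by
  classical
  obtain ⟨f₀⟩ := hne
  set T₀ : CMF (GalT F) conjT := pullType f₀.Φ σ₀ with hT₀
  let i₀ : Pl T₀ := rep T₀ (translate σ₀ f₀.p)
  haveI : Nonempty (Pl T₀) := ⟨i₀⟩
  obtain ⟨sel, hsel⟩ := exists_selector (Pl T₀)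
  have hn : Module.finrank ℚ F / 2 = Fintype.card (Pl T₀) := by
    rw [← FaceCensus.card_galT (F := F), ← two_mul_card T₀]; omega
  -- the half-system of base embeddings `{t σ₀ : t ∈ T₀}`
  set E : Finset (F →+* ℂ) := T₀.1.image fun t => t.1 σ₀ with hE
  have hEcard : E.card ≤ Fintype.card (Pl T₀) := by
    rw [Fintype.card_coe]; exact Finset.card_image_le
  have hEcover : ∀ σ : F →+* ℂ, σ ∈ E ∨ conjugate σ ∈ E := by
    intro σ
    rcases mem_or_conj_mem T₀ (translate σ₀ σ) with h | h
    · exact Or.inl (Finset.mem_image.mpr ⟨_, h, translate_apply_self σ₀ σ⟩)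
    · refine Or.inr (Finset.mem_image.mpr ⟨_, h, ?_⟩)
      rw [GalT.mul_apply, translate_apply_self, conjT_apply]
  -- the quotient dictionary `Asym F ≃ ℤ^{Ty}/pairs`
  let q : Asym F ≃ₗ[ℤ] (Ty (Pl T₀) → ℤ) ⧸ pairs (Pl T₀) :=
    Submodule.Quotient.equiv _ _ (vecOf T₀) (map_pairRel_eq T₀)
  have hq : ∀ y : CMF (GalT F) conjT →₀ ℤ, q (abar y) = (pairs (Pl T₀)).mkQ (vecOf T₀ y) := fun y => rfl
  -- the `n |𝒮|` classes
  set T : Finset ((Ty (Pl T₀) → ℤ) ⧸ pairs (Pl T₀)) :=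
    (𝒮 ×ˢ E).image fun p => (pairs (Pl T₀)).mkQ (vecOf T₀ (weightRel p.1.corner (fun _ => ({p.2} : Finset (F →+* ℂ))))) with hT
  have hTcard : T.card ≤ Fintype.card (Pl T₀) * 𝒮.card := by
    refine Finset.card_image_le.trans ?_
    rw [Finset.card_product, mul_comm]
    exact Nat.mul_le_mul_right _ hEcard
  -- Claim A: every read of a face of `𝒮` lands in `span T`
  have hA : ∀ g ∈ 𝒮, ∀ σ : F →+* ℂ,
      q (lefChar g.corner (fun _ => ({σ} : Finset (F →+* ℂ)))) ∈ Submodule.span ℤ (T : Set _) := by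
    intro g hg σ
    rcases hEcover σ with hσ | hσ
    · rw [← abar_weightRel, hq]
      exact Submodule.subset_span (Finset.mem_image.mpr ⟨(g, σ), Finset.mem_product.mpr ⟨hg, hσ⟩, rfl⟩)
    · have e : lefChar g.corner (fun _ => ({σ} : Finset (F →+* ℂ))) =
          -lefChar g.corner (fun _ => ({conjugate σ} : Finset (F →+* ℂ))) := by
        rw [lefChar_corner_conjugate, neg_neg]
      rw [e, map_neg, ← abar_weightRel, hq]
      exact Submodule.neg_mem _
        (Submodule.subset_span (Finset.mem_image.mpr ⟨(g, conjugate σ), Finset.mem_product.mpr ⟨hg, hσ⟩, rfl⟩))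
  -- Claim B: so does the `σ₀`-read of EVERY face
  have hB : ∀ f : Face F, q (lefChar f.corner (fun _ => ({σ₀} : Finset (F →+* ℂ)))) ∈ Submodule.span ℤ (T : Set _) := by
    intro f
    have hle : AddSubgroup.closure {a : Asym F | ∃ g ∈ (𝒮 : Set (Face F)), ∃ σ : F →+* ℂ,
        a = lefChar g.corner (fun _ => ({σ} : Finset (F →+* ℂ)))} ≤
        ((Submodule.span ℤ (T : Set _)).toAddSubgroup).comap q.toAddMonoidHom := by
      rw [AddSubgroup.closure_le]
      rintro _ ⟨g, hg, σ, rfl⟩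
      exact hA g hg σ
    exact hle (hgen f)
  -- Claim C: the image of the Hodge lattice lies in `span T`
  have hC : (hodge (Pl T₀)).map (pairs (Pl T₀)).mkQ ≤ Submodule.span ℤ (T : Set _) := by
    rw [← span_mkQ_bvec_eq (Pl T₀) i₀ hsel]
    refine Submodule.span_le.mpr ?_
    rintro _ ⟨Q, rfl⟩
    have h := hB (basisFace σ₀ T₀ hsel Q)
    rw [← abar_weightRel, hq, vecOf_weightRel_basisFace] at h
    exact h
  have h1 := Submodule.finrank_mono hC
  have h2 : Module.finrank ℤ (Submodule.span ℤ (T : Set ((Ty (Pl T₀) → ℤ) ⧸ pairs (Pl T₀)))) ≤ T.card :=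
    finrank_span_finset_le_card T
  have h0 : 2 ^ (Fintype.card (Pl T₀) - 1) - Fintype.card (Pl T₀) ≤ Fintype.card (Pl T₀) * 𝒮.card :=
    (finrank_hodge_mod_pairs (Pl T₀) i₀).symm.le.trans (h1.trans (h2.trans hTcard))
  have h3 := Census.GroupFreeFaceCoordinates.card_BIdx_add (Pl T₀) i₀
  rw [Census.GroupFreeFaceCoordinates.card_BIdx] at h3
  rw [hn]
  omega

end Summit.HodgeConjecture.CorCM.FaceBasis

end
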